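import Summits.RiemannHypothesis.RiemannHypothesis.Theses.UniversalFactor
import Literature.NumberTheory.LFunctions.DeBruijnHDiv
import Literature.NumberTheory.LFunctions.ZetaZeros

/-!
# Sketch (crux-ideate, ideator 2, gen 2): discrete Laguerre means at the zeros of Ξ

Crux `NarrowKernelNoGo` (stmt-RiemannHypothesis-2576). Lever: LP(F_a) forces, AT EVERY REAL ZERO x₀
OF H_0, the pointwise inequality F_a'(x₀)² ≥ a² F_a(x₀)² (Laguerre F'² − F F'' ≥ 0 plus the tree's
ODE F'' = a²(F − H_0), `deBruijnHDiv_laplace_sub_deriv_deriv`); summing over the zeta ordinates in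
(T, 2T] with nonnegative weights gives a DISCRETE MEAN that Landau–Gonek technology evaluates
asymptotically (fixed a, T → ∞). A negative value for one T refutes LP(F_a).
-/

noncomputable section

open Complex MeasureTheory Set

namespace Summit.RiemannHypothesis.RiemannHypothesis.Cruxes.NarrowKernelNoGo.SketchIdeator2g2

open Literature.NumberTheory.LFunctions
open Summit.RiemannHypothesis.RiemannHypothesis.Theses.UniversalFactor

/-- `F_a = deBruijnHDiv (1 + u²/a²)` (the crux's inline integral, by `rfl`). -/
abbrev F (a : ℝ) : ℂ → ℂ := deBruijnHDiv fun u : ℝ => 1 + u ^ 2 / a ^ 2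

/-- Real trace of `F_a` on the real axis. -/
def Fre (a : ℝ) (x : ℝ) : ℝ := (F a x).re

/-- Real trace of `H_0` on the real axis. -/
def H0re (x : ℝ) : ℝ := (deBruijnH 0 x).re

/-- FIRST LEMMA (M-size, Hadamard-free): LP(F_a) ⇒ at every real zero of `H_0`,
`a² F_a(x₀)² ≤ F_a'(x₀)²`. Proof plan: Laguerre `F'² − F F'' ≥ 0` on ℝ for the real entire
function `F_a` of order < 2 with only real zeros (`LaguerrePolya.exists_logDeriv_eq_sum_add_small_im`
route, as in the proved `laguerreLift`), and `F'' = a²(F − H_0)` (`deBruijnHDiv_laplace_sub_deriv_deriv`). -/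
def LaguerreAtZeros : Prop :=
  ∀ a : ℝ, 0 < a → HasOnlyRealZeros (F a) →
    ∀ x : ℝ, deBruijnH 0 (x : ℂ) = 0 → a ^ 2 * (Fre a x) ^ 2 ≤ (deriv (Fre a) x) ^ 2

/-- Sharper signed form at the zeros: `(F' + aF)·H_0' ≥ 0` and `(F' − aF)·H_0' ≥ 0`
(Laguerre for `M± = F' ± aF = ±a(1 ± D/a)F`, which are LP when `F` is, and `M₊' − aM₊ = −a²H_0`). -/
def SignedLaguerreAtZeros : Prop :=
  ∀ a : ℝ, 0 < a → HasOnlyRealZeros (F a) →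
    ∀ x : ℝ, deBruijnH 0 (x : ℂ) = 0 →
      0 ≤ (deriv (Fre a) x + a * Fre a x) * deriv H0re x ∧
      0 ≤ (deriv (Fre a) x - a * Fre a x) * deriv H0re x

/-- The arithmetic target (qualitative shape): for each `a ≥ 32` some finite set of real zeros of
`H_0` and nonnegative weights make the discrete Laguerre sum NEGATIVE. -/
def NegativeLaguerreSum : Prop :=
  ∀ a : ℝ, 32 ≤ a → ∃ (s : Finset ℝ) (w : ℝ → ℝ),
    (∀ x ∈ s, deBruijnH 0 (x : ℂ) = 0 ∧ 0 ≤ w x) ∧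
    ∑ x ∈ s, w x * ((deriv (Fre a) x) ^ 2 - a ^ 2 * (Fre a x) ^ 2) < 0

/-- The Hardy normalisation `E(t) = (1/16)(t² + 1/4) π^{-1/4} |Γ(1/4 + it/2)|`, so that
`H_0(2t) = −E(t) Z(t)`; dividing by `E(γ)²` makes the weights height-independent. -/
def hardyE (t : ℝ) : ℝ :=
  (1 / 16) * (t ^ 2 + 1 / 4) * Real.pi ^ (-(1 / 4 : ℝ)) * ‖Complex.Gamma (1 / 4 + I * t / 2)‖

/-- The quantitative form the Landau–Gonek evaluation should deliver (K1+K2 of the card): for each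
fixed `a ≥ 32`, the `E`-normalised discrete Laguerre mean over the ordinates in `(T, 2T]` is
`≤ −κ T log T` for all large `T` (κ = κ(a) > 0). Ordinates enumerated by `zetaOrdinate`
(with multiplicity); under RH (free on this crux, `Disproof.crux_iff_rh_imp`) `2γ_n` are exactly
the real zeros of `H_0`. -/
def DiscreteLaguerreMeanNegative : Prop :=
  ∀ a : ℝ, 32 ≤ a → ∃ κ : ℝ, 0 < κ ∧ ∃ T₀ : ℝ, ∀ T : ℝ, T₀ ≤ T →
    ∑ n ∈ (Finset.range (zetaZeroCount (2 * T))).filter (fun n => T < zetaOrdinate n),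
        (hardyE (zetaOrdinate n))⁻¹ ^ 2 *
          ((deriv (Fre a) (2 * zetaOrdinate n)) ^ 2 - a ^ 2 * (Fre a (2 * zetaOrdinate n)) ^ 2)
      ≤ -κ * T * Real.log T

/-! ## The pencil (main lever)

`LP(F_a) ⇒ (1 − D²/b²)F_a ∈ LP` for every `b > 0` (two Laguerre steps, exactly as in the proved
`laguerreLift`, with `b` free), and `(D² − b²)F_a = (a² − b²)F_a − a²H_0` by the ODE; so the whole
pencil `H_0 + κ F_a`, `κ = b²/a² − 1 ≥ −1`, is LP. Laguerre for the pencil member at a zero `x₀`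
of `H_0` (where `P = κF`, `P' = H' + κF'`, `P'' = H'' + κ a² F`) is a quadratic inequality in `κ`,
uniform in `κ ≥ −1`; summing over zeros FIRST and optimising `κ` AFTERWARDS gives a discriminant
condition on three discrete second moments at the zeta zeros. -/

/-- PENCIL LEMMA (provable now): LP(F_a) ⇒ every `H_0 + κ F_a`, `κ ≥ −1`, has only real zeros. -/
def PencilLP : Prop :=
  ∀ a : ℝ, 0 < a → HasOnlyRealZeros (F a) →
    ∀ κ : ℝ, -1 ≤ κ → HasOnlyRealZeros (fun z : ℂ => deBruijnH 0 z + (κ : ℂ) * F a z)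

/-- FIRST LEMMA of the main lever (M-size, Hadamard-free): the pencil Laguerre inequality at the
real zeros of `H_0`, uniformly in `κ ≥ −1`. -/
def PencilLaguerreAtZeros : Prop :=
  ∀ a : ℝ, 0 < a → HasOnlyRealZeros (F a) →
    ∀ κ : ℝ, -1 ≤ κ → ∀ x : ℝ, deBruijnH 0 (x : ℂ) = 0 →
      0 ≤ (deriv H0re x) ^ 2
          + κ * (2 * deriv H0re x * deriv (Fre a) x - Fre a x * deriv (deriv H0re) x)
          + κ ^ 2 * ((deriv (Fre a) x) ^ 2 - a ^ 2 * (Fre a x) ^ 2)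

/-- The arithmetic target of the main lever (qualitative shape): for each `a ≥ 32`, one finite set
of real zeros of `H_0`, nonnegative weights and one `κ ≥ −1` making the weighted pencil sum
NEGATIVE — equivalently (when `Q > 0`, `−B/2Q ≥ −1`) the discriminant condition `B² > 4AQ` for
`A = Σ w H_0'²`, `B = Σ w (2H_0'F' − F H_0'')`, `Q = Σ w (F'² − a²F²)`. Landau–Gonek discrete
moments give, for FIXED `a` and `T → ∞` (RH): `A ~ Gonek`, `|B| ≍ a L⁴… ≫`, `B²/(4AQ) → ∞`. -/
def NegativePencilSum : Prop :=
  ∀ a : ℝ, 32 ≤ a → ∃ (s : Finset ℝ) (w : ℝ → ℝ) (κ : ℝ), -1 ≤ κ ∧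
    (∀ x ∈ s, deBruijnH 0 (x : ℂ) = 0 ∧ 0 ≤ w x) ∧
    ∑ x ∈ s, w x * ((deriv H0re x) ^ 2
          + κ * (2 * deriv H0re x * deriv (Fre a) x - Fre a x * deriv (deriv H0re) x)
          + κ ^ 2 * ((deriv (Fre a) x) ^ 2 - a ^ 2 * (Fre a x) ^ 2)) < 0

/-- CHECKED COMPOSITION (main lever): pencil Laguerre at zeros + a negative pencil sum ⇒ crux. -/
theorem narrowKernelNoGo_of_pencil (h1 : PencilLaguerreAtZeros) (h2 : NegativePencilSum) :
    NarrowKernelNoGo := by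
  intro a ha hLP
  obtain ⟨s, w, κ, hκ, hs, hneg⟩ := h2 a ha
  have hLP' : HasOnlyRealZeros (F a) := hLP
  have hnn : 0 ≤ ∑ x ∈ s, w x * ((deriv H0re x) ^ 2
          + κ * (2 * deriv H0re x * deriv (Fre a) x - Fre a x * deriv (deriv H0re) x)
          + κ ^ 2 * ((deriv (Fre a) x) ^ 2 - a ^ 2 * (Fre a x) ^ 2)) :=
    Finset.sum_nonneg fun x hx => mul_nonneg (hs x hx).2 (h1 a (by linarith) hLP' κ hκ x (hs x hx).1)
  linarith

/-- CHECKED COMPOSITION: the first lemma plus a negative discrete Laguerre sum give the crux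
(the crux's inline integral is `F a` by `rfl`). -/
theorem narrowKernelNoGo_of (h1 : LaguerreAtZeros) (h2 : NegativeLaguerreSum) :
    NarrowKernelNoGo := by
  intro a ha hLP
  obtain ⟨s, w, hs, hneg⟩ := h2 a ha
  have hLP' : HasOnlyRealZeros (F a) := hLP
  have hnn : 0 ≤ ∑ x ∈ s, w x * ((deriv (Fre a) x) ^ 2 - a ^ 2 * (Fre a x) ^ 2) := by
    refine Finset.sum_nonneg fun x hx => mul_nonneg (hs x hx).2 ?_
    have := h1 a (by linarith) hLP' x (hs x hx).1
    linarith
  linarith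

end Summit.RiemannHypothesis.RiemannHypothesis.Cruxes.NarrowKernelNoGo.SketchIdeator2g2
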